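import Summits.RiemannHypothesis.RiemannHypothesis.Theorems.WeilFormatCDataO109FrontDataW
import Summits.RiemannHypothesis.RiemannHypothesis.Theorems.WeilFormatCDataA1RungCB
import Summits.RiemannHypothesis.RiemannHypothesis.Theorems.S2FormatCE0
import Literature.NumberTheory.LFunctions.YoshidaWindowGramTailMSSines
import Literature.NumberTheory.LFunctions.YoshidaWindowGramMiddleJBox
import Literature.NumberTheory.LFunctions.YoshidaWindowGramTailJFactoredScaled
import Literature.NumberTheory.LFunctions.YoshidaWindowGramTailMSFactored
import Literature.NumberTheory.LFunctions.YoshidaWindowGramTailJDiagTight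
import Summits.RiemannHypothesis.RiemannHypothesis.Theorems.FormatCPsdBands
import Summits.RiemannHypothesis.RiemannHypothesis.Theorems.WeilFormatCDiagShift
import Summits.RiemannHypothesis.RiemannHypothesis.Theorems.FormatCPsdSymmBands
import HarnessLib
import Summits.RiemannHypothesis.RiemannHypothesis.Theorems.WeilFormatCDataO109CBOddPsd0
import Summits.RiemannHypothesis.RiemannHypothesis.Theorems.WeilFormatCDataO109CBOddPsd1
import Summits.RiemannHypothesis.RiemannHypothesis.Theorems.WeilFormatCDataO109CBOddPsd2
import Summits.RiemannHypothesis.RiemannHypothesis.Theorems.WeilFormatCDataO109CBOddPsd3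
import Summits.RiemannHypothesis.RiemannHypothesis.Theorems.WeilFormatCDataO109CBOddPsd4
import Summits.RiemannHypothesis.RiemannHypothesis.Theorems.WeilFormatCDataO109CBOddPsd5
import Summits.RiemannHypothesis.RiemannHypothesis.Theorems.WeilFormatCDataO109CBOddPsd6
import Summits.RiemannHypothesis.RiemannHypothesis.Theorems.WeilFormatCDataO109CBOddPsd7
import Summits.RiemannHypothesis.RiemannHypothesis.Theorems.WeilFormatCDataO109CBOddPsd8
import Summits.RiemannHypothesis.RiemannHypothesis.Theorems.WeilFormatCDataO109CBOddPsd9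
import Summits.RiemannHypothesis.RiemannHypothesis.Theorems.WeilFormatCDataO109CBOddPsd10
import Summits.RiemannHypothesis.RiemannHypothesis.Theorems.WeilFormatCDataO109CBOddPsd11
import Summits.RiemannHypothesis.RiemannHypothesis.Theorems.WeilFormatCDataO109CBOddPsd12
import Summits.RiemannHypothesis.RiemannHypothesis.Theorems.WeilFormatCDataO109CBOddPsd13
import Summits.RiemannHypothesis.RiemannHypothesis.Theorems.WeilFormatCDataO109CBOddPsd14
import Summits.RiemannHypothesis.RiemannHypothesis.Theorems.WeilFormatCDataO109CBOddPsd15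
import Summits.RiemannHypothesis.RiemannHypothesis.Theorems.WeilFormatCDataO109CBOddPsd16
import Summits.RiemannHypothesis.RiemannHypothesis.Theorems.WeilFormatCDataO109CBOddPsd17
import Summits.RiemannHypothesis.RiemannHypothesis.Theorems.WeilFormatCDataO109CBOddPsd18
import Summits.RiemannHypothesis.RiemannHypothesis.Theorems.WeilFormatCDataO109CBOddPsd19A
import Summits.RiemannHypothesis.RiemannHypothesis.Theorems.WeilFormatCDataO109CBOddPsd19B
import Summits.RiemannHypothesis.RiemannHypothesis.Theorems.WeilFormatCDataO109OddAsmA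

/-!
# Format C kernel rung `O109` (a = 109/100, column-band layout): ASSEMBLY of the flat layout, part K of 11 (ladders of CBOddPsd19 (cont.); split of the 2865-line assembly at block boundaries by prover B g19 for the 400-line cap; blocks byte-identical): every propositional ladder of the kernel files (table/column validity, front door, sines, middle moments, column data, tail factors, Schur rows, (P) + diagonal shift), byte-identical statements and proofs, original order (A g22 restage_flat.py; weil-2 KERNEL-CHAIN-RULES #1)

Window `a = 109/100`; prime powers in the window: 2, 3, 2^2, 5, 7, 2^3; prime constant A = 2358/1000 (`WeilFormatC.primeCoeff_form_ge_cells_1098`); evaluator parameters S = 2^320, Kpi 160, Kser 190, kred 8, Kexp 55, J 150; full table modes < 321; light column table modes < 2051; units 2^-310 (Schur entries), 2^-154 (column digits, width 157), 2^-148 (tail-factor digits, width 151), 2^-64 (reciprocal weights), 2^-40 (tail base); order-J tail J = 4, θ = 1/2048, η = 1/10 | 4/1.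
Design row: sr-gb-rung-b B g22 hp odd λ-run = PARITY CELL 17 L-SIDE: a = 109/100 with SIX prime powers 2,3,4,5,7,8 (kmax 8; WeilFormatC.primeCoeff_form_ge_cells_1098, A = 2358/1000; 0.0086 below the (log 9)/2 resonance — the last full cell of this kit), μ = 2^-113 = 9.6e-35, odd 320/640/2048, kit precision S 2^320 / c 310 / Kpi 160 / Kser 190 / Kexp 55 / J 150 (A g23 hp levers), MS tail; probes (B g22): λ_min(DS) 8.15e-35 @ 109/100, 3.75e-34 @ 217/200 (Bo 320); see HOME(B)/CELL16-LSIDE-B-g22.md. Generated by sr-gb-rung-a prover A g22 with rh-explicit-weil-2 gen7's generator extended for the odd λ-run (--sector odd --mu-log2; HOME(A)/code-g22/gen7/gramgen7.py sha16 b22c17hp00000109) from `#eval` of the tree's `Encl` functions; every datum is re-verified by the kernel in the theorem files (`decide +kernel`). Helper data of the rh-explicit Weil-positivity programme (format C, K-CELL-2), RH-free. [cite: Yoshida1992HermitianForms, §5 (5.15)-(5.16) p. 301; §7 pp. 305–312]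
-/

set_option linter.dupNamespace false
set_option exponentiation.threshold 1024
set_option maxRecDepth 200000

-- ===== from WeilFormatCDataO109CBOddPsd19 (continued) =====
namespace Summit.RiemannHypothesis.RiemannHypothesis.Theorems.WeilFormatCData.O109CBOdd
open Literature.NumberTheory.LFunctions Literature.NumberTheory.LFunctions.PsdDyadic Summit.RiemannHypothesis.RiemannHypothesis.Theorems.FormatCPsd

/-- **λ-run**: `DS' = DS − lamZ·1` on the whole `320 × 320` block (assembled from the row bands). -/
theorem hDS : ∀ k < 320, ∀ k' < 320, PsdDyadic.getMZ O109CBOdd.DS' k k' = PsdDyadic.getMZ O109CBOdd.DS k k' - (if k = k' then O109CBOdd.lamZ else 0) := by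
  intro k hk
  by_cases hs0 : k < 8
  · exact WeilFormatC.diagShift_row_of_check tSh0 k (by omega) (by omega)
  by_cases hs8 : k < 16
  · exact WeilFormatC.diagShift_row_of_check tSh8 k (by omega) (by omega)
  by_cases hs16 : k < 24
  · exact WeilFormatC.diagShift_row_of_check tSh16 k (by omega) (by omega)
  by_cases hs24 : k < 32
  · exact WeilFormatC.diagShift_row_of_check tSh24 k (by omega) (by omega)
  by_cases hs32 : k < 40
  · exact WeilFormatC.diagShift_row_of_check tSh32 k (by omega) (by omega)
  by_cases hs40 : k < 48
  · exact WeilFormatC.diagShift_row_of_check tSh40 k (by omega) (by omega)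
  by_cases hs48 : k < 56
  · exact WeilFormatC.diagShift_row_of_check tSh48 k (by omega) (by omega)
  by_cases hs56 : k < 64
  · exact WeilFormatC.diagShift_row_of_check tSh56 k (by omega) (by omega)
  by_cases hs64 : k < 72
  · exact WeilFormatC.diagShift_row_of_check tSh64 k (by omega) (by omega)
  by_cases hs72 : k < 80
  · exact WeilFormatC.diagShift_row_of_check tSh72 k (by omega) (by omega)
  by_cases hs80 : k < 88
  · exact WeilFormatC.diagShift_row_of_check tSh80 k (by omega) (by omega)
  by_cases hs88 : k < 96
  · exact WeilFormatC.diagShift_row_of_check tSh88 k (by omega) (by omega)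
  by_cases hs96 : k < 104
  · exact WeilFormatC.diagShift_row_of_check tSh96 k (by omega) (by omega)
  by_cases hs104 : k < 112
  · exact WeilFormatC.diagShift_row_of_check tSh104 k (by omega) (by omega)
  by_cases hs112 : k < 120
  · exact WeilFormatC.diagShift_row_of_check tSh112 k (by omega) (by omega)
  by_cases hs120 : k < 128
  · exact WeilFormatC.diagShift_row_of_check tSh120 k (by omega) (by omega)
  by_cases hs128 : k < 136
  · exact WeilFormatC.diagShift_row_of_check tSh128 k (by omega) (by omega)
  by_cases hs136 : k < 144
  · exact WeilFormatC.diagShift_row_of_check tSh136 k (by omega) (by omega)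
  by_cases hs144 : k < 152
  · exact WeilFormatC.diagShift_row_of_check tSh144 k (by omega) (by omega)
  by_cases hs152 : k < 160
  · exact WeilFormatC.diagShift_row_of_check tSh152 k (by omega) (by omega)
  by_cases hs160 : k < 168
  · exact WeilFormatC.diagShift_row_of_check tSh160 k (by omega) (by omega)
  by_cases hs168 : k < 176
  · exact WeilFormatC.diagShift_row_of_check tSh168 k (by omega) (by omega)
  by_cases hs176 : k < 184
  · exact WeilFormatC.diagShift_row_of_check tSh176 k (by omega) (by omega)
  by_cases hs184 : k < 192
  · exact WeilFormatC.diagShift_row_of_check tSh184 k (by omega) (by omega)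
  by_cases hs192 : k < 200
  · exact WeilFormatC.diagShift_row_of_check tSh192 k (by omega) (by omega)
  by_cases hs200 : k < 208
  · exact WeilFormatC.diagShift_row_of_check tSh200 k (by omega) (by omega)
  by_cases hs208 : k < 216
  · exact WeilFormatC.diagShift_row_of_check tSh208 k (by omega) (by omega)
  by_cases hs216 : k < 224
  · exact WeilFormatC.diagShift_row_of_check tSh216 k (by omega) (by omega)
  by_cases hs224 : k < 232
  · exact WeilFormatC.diagShift_row_of_check tSh224 k (by omega) (by omega)
  by_cases hs232 : k < 240
  · exact WeilFormatC.diagShift_row_of_check tSh232 k (by omega) (by omega)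
  by_cases hs240 : k < 248
  · exact WeilFormatC.diagShift_row_of_check tSh240 k (by omega) (by omega)
  by_cases hs248 : k < 256
  · exact WeilFormatC.diagShift_row_of_check tSh248 k (by omega) (by omega)
  by_cases hs256 : k < 264
  · exact WeilFormatC.diagShift_row_of_check tSh256 k (by omega) (by omega)
  by_cases hs264 : k < 272
  · exact WeilFormatC.diagShift_row_of_check tSh264 k (by omega) (by omega)
  by_cases hs272 : k < 280
  · exact WeilFormatC.diagShift_row_of_check tSh272 k (by omega) (by omega)
  by_cases hs280 : k < 288
  · exact WeilFormatC.diagShift_row_of_check tSh280 k (by omega) (by omega)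
  by_cases hs288 : k < 296
  · exact WeilFormatC.diagShift_row_of_check tSh288 k (by omega) (by omega)
  by_cases hs296 : k < 304
  · exact WeilFormatC.diagShift_row_of_check tSh296 k (by omega) (by omega)
  by_cases hs304 : k < 312
  · exact WeilFormatC.diagShift_row_of_check tSh304 k (by omega) (by omega)
  exact WeilFormatC.diagShift_row_of_check tSh312 k (by omega) (by omega)

end Summit.RiemannHypothesis.RiemannHypothesis.Theorems.WeilFormatCData.O109CBOdd
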